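import Summits.ResolutionOfSingularities.ResolutionOfSingularities.Theorems.EquisingularLiftEquisingularLiftReducedStrictTransformBlowup
import Summits.ResolutionOfSingularities.ResolutionOfSingularities.Theorems.EquisingularLiftEquisingularLiftCentreBlowupFlatExceptional
import Literature.AlgebraicGeometry.Resolution.ExceptionalDivisorRegularGlobal
import Literature.AlgebraicGeometry.Resolution.AlterationsProofs
import Mathlib.AlgebraicGeometry.Morphisms.Flat
import Mathlib.AlgebraicGeometry.IdealSheaf.Functorial
import HarnessLib

/-!
# [OURS · L1 W4.5(b) · EL♮] R1-IN-CARRIER: the exceptional trace of the strict transform of a regular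
# carrier divisor is a regular, `O`-flat centre (scheme level, chart-free)

Crux `EquisingularLiftNat` = stmt-ResolutionOfSingularities-20038 (route `EquisingularLift`, chain w45b), registered line
`sections`, stub `stub_elnat_three_isolated_nonabs`; helper `--supports … --as helper` by res-L1-w45b-stub-1
(res-L1-w45b-plan-1 ORDERS AMENDMENT 2 (a) «stub-1 GO: R1-IN-CARRIER», 2026-08-27T06:53:05Z; design note
06:46:09Z; res-L1-w45b-lead-2 TARGET (2) T-CARRIER-Δ shares the skeleton). OURS: replaces the role of NOTHING in
H. Hironaka's manuscript and is NOT a statement of it; AI-written kernel lemma, weaker than expert review.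

THE GAP IT FILLS. Every isolated-side rung of EL♮(3) beyond T-ISO-0 (p505885: point centres only) needs a CURVE centre at
stage ≥ 1 lying inside a point-carrier `E_s` (the exceptional divisor of an earlier section blow-up): the first instance is
the `O`-line `ℓ̃ = E_s ∩ St(Π̃)` of the specimen `V(x₀²x₃² + x₁⁴ + x₂⁴)` (T-ISO-1; downstairs charts p504547), `Π̃` an
`O`-plane through the section `s`. This file constructs such centres CHART-FREE and proves the `IsRegular` and `Flat` entries
of res-L1-w45b-lead-2's HorizChainE1 step for them, together with the support formula needed for the E1 / off-generic entries.

SETTING. `q : X → Spec O`; a centre `C : X.IdealSheafData` (e.g. `s.ker` for a section `s`); a proper blow-up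
`τ : X' → X` along `C` (`IsBlowup`); a closed irreducible `S ⊆ X` not inside `V(C)` — the CARRIER DIVISOR (e.g. the `O`-plane
`Π̃ ∋ s`) — with reduced structure `D = V(S)_red ↪ X` and restricted centre `J := C·𝒪_D = C.comap ι_D` (`= s` inside `Π̃`).
The reduced strict transform is `T := V(closure τ⁻¹(S ∖ V(C)))_red ↪ X'` (the currency of
`…EquisingularLiftNatStrictTransformCentre.lean`, res-L1-w45b-stub-3), which is a blow-up `ρ : T → D` of `D` along `J`
(tree theorem `StrataSplit.exists_isBlowup_reducedStrictTransform`, Stacks 080E (1), p167331).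

THE IN-CARRIER CENTRE is the ideal sheaf
  `L := ((C.comap τ).comap ι_T).map ι_T : X'.IdealSheafData`
— the exceptional ideal `C·𝒪_{X'}` restricted to `T` and pushed forward to `X'`; `V(L) = T ∩ E` scheme-theoretically, i.e.
`V(L) ≅ E_T := V(J·𝒪_T)`, the exceptional divisor of `ρ` (`inCarrier_eq_ker`: `L` is the kernel of `E_T ↪ T ↪ X'`; it does not
depend on the choice of `ρ`). PROVED:

* `support_map_comap_subschemeι` (general) — `supp ((A.comap ι_I).map ι_I) = supp I ∩ supp A`; hence
  `support_inCarrier`: **`supp L = closure τ⁻¹(S ∖ V(C)) ∩ τ⁻¹ V(C)`**, and `image_support_inCarrier_subset`: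
  `τ(supp L) ⊆ V(C)` (the off-generic entry: the centre lies over the old centre);
* `le_map_comap_subschemeι`, `ker_le_map_comap_subschemeι`, `map_comap_subschemeι_eq_sup` (general) —
  `(A.comap ι_I).map ι_I = I ⊔ A`; hence `inCarrier_eq_vanishingIdeal_sup_comap`: **`L = 𝓘(St S) ⊔ C·𝒪_{X'}`** EXACTLY
  (res-L1-w45b-lead-2's T-CARRIER-Δ definition «C := St_τ(K) ⊔ E», with `St` the ideal of the reduced strict transform);
* `inCarrier_eq_ker` — for ANY `ρ : T → D` over `τ` which is a blow-up along `J`: `L = ker (E_T ↪ T ↪ X')`;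
* **`isRegular_inCarrier`** — if `D` and `V(J)` are regular then `V(L)` is REGULAR: `V(L) ≅ E_T` (`IsClosedImmersion.isIso_lift`)
  and the exceptional divisor of the blow-up of a regular scheme along a regular centre is regular (tree theorem
  `IsBlowup.isRegular_subscheme_comap`, Liu Thm. 8.1.19 (b));
* **`flat_inCarrier_comp`** — if moreover `V(J) ↪ D → X → Spec O` is flat then `V(L) ↪ X' → X → Spec O` is FLAT (tree theorem
  `StrataSplit.flat_exceptional_of_isBlowup_regularCentre` p460210 for `ρ`, transported along `ρ ≫ ι_D = ι_T ≫ τ`);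
* `inCarrier_stepData` — the two entries bundled with the support facts, in the order of a HorizChainE1 step.
* (rev 2) `vanishingIdeal_support_eq_of_isReduced` (`𝓘(supp K) = K` for `V(K)` reduced), `exists_iso_comap_subscheme_of_le` /
  `isRegular_comap_subscheme_of_le` / `flat_comap_subschemeι_comp_of_le` (`V(K·𝒪_{V(I)}) ≅ V(K)` for `I ≤ K`), and
  **`inCarrier_stepData_of_le`**: the carrier given by an ideal sheaf `K ≤ C` (`V(K)` regular with irreducible support, `V(C)`
  regular and `O`-flat) — the shape in which R1's linear centres (plane `Λ_plane ≤ Λ_point` point) are consumed.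

LINE-IN-POINT-CARRIER instance (T-ISO-1): `C = s.ker`, `S = Π̃` an `O`-plane through `s` in `X = ℙ³_O`; then `D ≅ ℙ²_O` is
regular (R1 (P1), res-D-pv-013, + `vanishingIdeal_support`), `V(J) = s ∩ Π̃ ≅ Spec O` is regular and flat, and `V(L) = ℓ̃` is
the `O`-line `E_s ∩ St(Π̃) ≅ ℙ¹_O` with special fibre the line `ℓ = ℙ(T_{s₀}Π̃_k) ⊂ E_{s,k}`; E1 reads `ℓ ⊆ H₁`. The Δ-centres of
T-CARRIER-Δ (`S` = a cone `K` through `s`, not regular at `s`) share `L`, `support_inCarrier`, the «St ⊔ E» inequality and the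
flatness transport verbatim; only the regularity input differs (Δ-criterion charts D1 instead of Liu 8.1.19 (b)).
References: Q. Liu, *Algebraic Geometry and Arithmetic Curves* (2002), Thm. 8.1.19; The Stacks Project, Tags 080E, 0806.
-/

set_option linter.dupNamespace false -- mandated namespace `Summit.<Summit>.<Problem>` of this single-conjunct summit

noncomputable section

open CategoryTheory CategoryTheory.Limits AlgebraicGeometry TopologicalSpace Topology
open Literature.AlgebraicGeometry.Resolution
open Summit.ResolutionOfSingularities.ResolutionOfSingularities.Cruxes.EquisingularLift.StrataSplit

namespace Summit.ResolutionOfSingularities.ResolutionOfSingularities.Cruxes.EquisingularLiftNat.Sections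

/-! ## Generalities: `(A·𝒪_{V(I)})` pushed forward to the ambient -/

/-- **Support.** For ideal sheaves `A`, `I` on `X'`: the support of `(A.comap ι_I).map ι_I` (restrict `A` to `V(I)`, push
forward) is `supp I ∩ supp A`. [folklore] -/
theorem support_map_comap_subschemeι {X' : Scheme.{0}} (A I : X'.IdealSheafData) :
    (((A.comap I.subschemeι).map I.subschemeι).support : Set X') = (I.support : Set X') ∩ (A.support : Set X') := by
  rw [Scheme.IdealSheafData.support_map, Scheme.IdealSheafData.support_comap, Closeds.coe_closure,
    Closeds.coe_preimage, Set.image_preimage_eq_inter_range, Scheme.IdealSheafData.range_subschemeι,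
    Set.inter_comm]
  exact (I.support.isClosed.inter A.support.isClosed).closure_eq

/-- `A ≤ (A.comap ι_I).map ι_I`. [folklore] -/
theorem le_map_comap_subschemeι {X' : Scheme.{0}} (A I : X'.IdealSheafData) :
    A ≤ (A.comap I.subschemeι).map I.subschemeι :=
  Scheme.IdealSheafData.le_map_iff_comap_le.mpr le_rfl

/-- `I ≤ (A.comap ι_I).map ι_I` (`I = ker ι_I = (⊥).map ι_I`). [folklore] -/
theorem ker_le_map_comap_subschemeι {X' : Scheme.{0}} (A I : X'.IdealSheafData) :
    I ≤ (A.comap I.subschemeι).map I.subschemeι := by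
  conv_lhs => rw [← Scheme.IdealSheafData.ker_subschemeι I, ← Scheme.IdealSheafData.map_bot]
  exact Scheme.IdealSheafData.map_mono _ bot_le

/-- `I ⊔ A ≤ (A.comap ι_I).map ι_I`. [folklore] -/
theorem sup_le_map_comap_subschemeι {X' : Scheme.{0}} (A I : X'.IdealSheafData) :
    I ⊔ A ≤ (A.comap I.subschemeι).map I.subschemeι :=
  sup_le (ker_le_map_comap_subschemeι A I) (le_map_comap_subschemeι A I)

/-- **`(A·𝒪_{V(I)})` pushed forward IS `I ⊔ A`**: `(A.comap ι_I).map ι_I = I ⊔ A` — the subscheme `V(I) ∩ V(A)` maps to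
`V(A·𝒪_{V(I)}) = V(I) ×_{X'} V(A)` over `X'`, which bounds the kernel from above; the other inequality is
`sup_le_map_comap_subschemeι`. [folklore] -/
theorem map_comap_subschemeι_eq_sup {X' : Scheme.{0}} (A I : X'.IdealSheafData) :
    (A.comap I.subschemeι).map I.subschemeι = I ⊔ A := by
  refine le_antisymm ?_ (sup_le_map_comap_subschemeι A I)
  -- `g : V(I ⊔ A) → V(A.comap ι_I) ≅ V(I) ×_{X'} V(A)` over `X'`
  let g : (I ⊔ A).subscheme ⟶ (A.comap I.subschemeι).subscheme :=
    pullback.lift (Scheme.IdealSheafData.inclusion (le_sup_left : I ≤ I ⊔ A))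
        (Scheme.IdealSheafData.inclusion (le_sup_right : A ≤ I ⊔ A))
        (by rw [Scheme.IdealSheafData.inclusion_subschemeι, Scheme.IdealSheafData.inclusion_subschemeι]) ≫
      (A.comapIso I.subschemeι).inv
  have hg : g ≫ (A.comap I.subschemeι).subschemeι ≫ I.subschemeι = (I ⊔ A).subschemeι := by
    simp only [g, Category.assoc, Scheme.IdealSheafData.comapIso_inv_subschemeι_assoc, pullback.lift_fst_assoc,
      Scheme.IdealSheafData.inclusion_subschemeι]
  rw [Scheme.IdealSheafData.map, ← (I ⊔ A).ker_subschemeι, ← hg]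
  exact Scheme.Hom.le_ker_comp _ _

/-! ## The in-carrier centre `L = ((C·𝒪_{X'})·𝒪_T)` pushed to `X'` -/

/-- **Support of the in-carrier centre**: `supp L = St(S) ∩ τ⁻¹V(C)` where `St(S) = closure τ⁻¹(S ∖ V(C))` is the strict
transform of the carrier. [folklore] -/
theorem support_inCarrier {X X' : Scheme.{0}} (τ : X' ⟶ X) (C : X.IdealSheafData) (S : Set X) :
    ((((C.comap τ).comap (Scheme.IdealSheafData.vanishingIdeal
        (⟨closure (τ ⁻¹' (S \ (C.support : Set X))), isClosed_closure⟩ : Closeds X')).subschemeι).map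
        (Scheme.IdealSheafData.vanishingIdeal
          (⟨closure (τ ⁻¹' (S \ (C.support : Set X))), isClosed_closure⟩ : Closeds X')).subschemeι).support : Set X') =
      closure (τ ⁻¹' (S \ (C.support : Set X))) ∩ τ ⁻¹' (C.support : Set X) := by
  rw [support_map_comap_subschemeι, Scheme.IdealSheafData.coe_support_vanishingIdeal,
    Scheme.IdealSheafData.support_comap, Closeds.coe_preimage]
  rfl

/-- **Off-generic input**: the in-carrier centre lies over the old centre, `τ(supp L) ⊆ V(C)`. [folklore] -/
theorem image_support_inCarrier_subset {X X' : Scheme.{0}} (τ : X' ⟶ X) (C : X.IdealSheafData) (S : Set X) :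
    τ '' ((((C.comap τ).comap (Scheme.IdealSheafData.vanishingIdeal
        (⟨closure (τ ⁻¹' (S \ (C.support : Set X))), isClosed_closure⟩ : Closeds X')).subschemeι).map
        (Scheme.IdealSheafData.vanishingIdeal
          (⟨closure (τ ⁻¹' (S \ (C.support : Set X))), isClosed_closure⟩ : Closeds X')).subschemeι).support : Set X') ⊆
      (C.support : Set X) := by
  rw [support_inCarrier, Set.image_subset_iff]
  exact Set.inter_subset_right

/-- **«St ⊔ E ≤ L»**: the ideal of the (reduced) strict transform of the carrier and the exceptional ideal `C·𝒪_{X'}` both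
lie in the in-carrier centre. [folklore] -/
theorem vanishingIdeal_sup_comap_le_inCarrier {X X' : Scheme.{0}} (τ : X' ⟶ X) (C : X.IdealSheafData) (S : Set X) :
    Scheme.IdealSheafData.vanishingIdeal
        (⟨closure (τ ⁻¹' (S \ (C.support : Set X))), isClosed_closure⟩ : Closeds X') ⊔ C.comap τ ≤
      ((C.comap τ).comap (Scheme.IdealSheafData.vanishingIdeal
        (⟨closure (τ ⁻¹' (S \ (C.support : Set X))), isClosed_closure⟩ : Closeds X')).subschemeι).map
        (Scheme.IdealSheafData.vanishingIdeal
          (⟨closure (τ ⁻¹' (S \ (C.support : Set X))), isClosed_closure⟩ : Closeds X')).subschemeι :=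
  sup_le_map_comap_subschemeι _ _

/-- **«L = St ⊔ E» exactly** (res-L1-w45b-lead-2's T-CARRIER-Δ definition `C := St_τ(K) ⊔ E`, with `St` the ideal of the
REDUCED strict transform): the in-carrier centre is the ideal of the strict transform plus the exceptional ideal. [folklore] -/
theorem inCarrier_eq_vanishingIdeal_sup_comap {X X' : Scheme.{0}} (τ : X' ⟶ X) (C : X.IdealSheafData) (S : Set X) :
    ((C.comap τ).comap (Scheme.IdealSheafData.vanishingIdeal
        (⟨closure (τ ⁻¹' (S \ (C.support : Set X))), isClosed_closure⟩ : Closeds X')).subschemeι).map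
        (Scheme.IdealSheafData.vanishingIdeal
          (⟨closure (τ ⁻¹' (S \ (C.support : Set X))), isClosed_closure⟩ : Closeds X')).subschemeι =
      Scheme.IdealSheafData.vanishingIdeal
        (⟨closure (τ ⁻¹' (S \ (C.support : Set X))), isClosed_closure⟩ : Closeds X') ⊔ C.comap τ :=
  map_comap_subschemeι_eq_sup _ _

/-- **`L` is the kernel of `E_T ↪ T ↪ X'`** for every `ρ : T → D` over `τ` (`ρ ≫ ι_D = ι_T ≫ τ`), where
`E_T = V((C.comap ι_D).comap ρ)` is the exceptional subscheme of `ρ`; in particular `L` does not depend on `ρ`. [folklore] -/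
theorem inCarrier_eq_ker {X X' : Scheme.{0}} (τ : X' ⟶ X) (C : X.IdealSheafData) (S : Set X) (hS : IsClosed S)
    (ρ : (Scheme.IdealSheafData.vanishingIdeal
        (⟨closure (τ ⁻¹' (S \ (C.support : Set X))), isClosed_closure⟩ : Closeds X')).subscheme ⟶
        (Scheme.IdealSheafData.vanishingIdeal (⟨S, hS⟩ : Closeds X)).subscheme)
    (hρ : ρ ≫ (Scheme.IdealSheafData.vanishingIdeal (⟨S, hS⟩ : Closeds X)).subschemeι =
      (Scheme.IdealSheafData.vanishingIdeal
        (⟨closure (τ ⁻¹' (S \ (C.support : Set X))), isClosed_closure⟩ : Closeds X')).subschemeι ≫ τ) :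
    ((C.comap τ).comap (Scheme.IdealSheafData.vanishingIdeal
        (⟨closure (τ ⁻¹' (S \ (C.support : Set X))), isClosed_closure⟩ : Closeds X')).subschemeι).map
        (Scheme.IdealSheafData.vanishingIdeal
          (⟨closure (τ ⁻¹' (S \ (C.support : Set X))), isClosed_closure⟩ : Closeds X')).subschemeι =
      (((C.comap (Scheme.IdealSheafData.vanishingIdeal (⟨S, hS⟩ : Closeds X)).subschemeι).comap ρ).subschemeι ≫
        (Scheme.IdealSheafData.vanishingIdeal
          (⟨closure (τ ⁻¹' (S \ (C.support : Set X))), isClosed_closure⟩ : Closeds X')).subschemeι).ker := by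
  rw [Scheme.Hom.ker_comp, Scheme.IdealSheafData.ker_subschemeι, ← Scheme.IdealSheafData.comap_comp,
    ← Scheme.IdealSheafData.comap_comp, hρ]

/-! ## Regularity and flatness -/

/-- **R1-IN-CARRIER, regularity.** If the carrier `D = V(S)_red` and the restricted centre `V(C·𝒪_D)` are regular, the
in-carrier centre `V(L) ⊆ X'` is regular: it is isomorphic to the exceptional divisor of the blow-up `ρ : T → D` of the
regular `D` along the regular `V(C·𝒪_D)` (Stacks 080E (1); `IsClosedImmersion.isIso_lift`), which is regular by
Liu Thm. 8.1.19 (b) (tree theorem `IsBlowup.isRegular_subscheme_comap`). [cite: Liu2002, Thm. 8.1.19 (b)] -/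
theorem isRegular_inCarrier (X X' : Scheme.{0}) [IsLocallyNoetherian X] [IsLocallyNoetherian X']
    (τ : X' ⟶ X) (C : X.IdealSheafData) (hτ : IsBlowup τ C) [IsProper τ]
    (S : Set X) (hS : IsClosed S) (hirr : IsIrreducible S) (hSC : ¬ S ⊆ (C.support : Set X))
    (hD : Scheme.IsRegular (Scheme.IdealSheafData.vanishingIdeal (⟨S, hS⟩ : Closeds X)).subscheme)
    (hJ : Scheme.IsRegular (C.comap (Scheme.IdealSheafData.vanishingIdeal (⟨S, hS⟩ : Closeds X)).subschemeι).subscheme) :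
    Scheme.IsRegular (((C.comap τ).comap (Scheme.IdealSheafData.vanishingIdeal
        (⟨closure (τ ⁻¹' (S \ (C.support : Set X))), isClosed_closure⟩ : Closeds X')).subschemeι).map
        (Scheme.IdealSheafData.vanishingIdeal
          (⟨closure (τ ⁻¹' (S \ (C.support : Set X))), isClosed_closure⟩ : Closeds X')).subschemeι).subscheme := by
  obtain ⟨ρ, hcomm, -, hρ⟩ := exists_isBlowup_reducedStrictTransform X X' τ C hτ S hS hirr hSC
  haveI : IsLocallyNoetherian (Scheme.IdealSheafData.vanishingIdeal (⟨S, hS⟩ : Closeds X)).subscheme :=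
    LocallyOfFiniteType.isLocallyNoetherian
      (Scheme.IdealSheafData.vanishingIdeal (⟨S, hS⟩ : Closeds X)).subschemeι
  -- the exceptional divisor `E_T` of `ρ` is regular
  have hE : Scheme.IsRegular ((C.comap
      (Scheme.IdealSheafData.vanishingIdeal (⟨S, hS⟩ : Closeds X)).subschemeι).comap ρ).subscheme :=
    hρ.isRegular_subscheme_comap hD hJ
  -- `E_T ≅ V(L)` over `X'`
  set L := ((C.comap τ).comap (Scheme.IdealSheafData.vanishingIdeal
        (⟨closure (τ ⁻¹' (S \ (C.support : Set X))), isClosed_closure⟩ : Closeds X')).subschemeι).map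
        (Scheme.IdealSheafData.vanishingIdeal
          (⟨closure (τ ⁻¹' (S \ (C.support : Set X))), isClosed_closure⟩ : Closeds X')).subschemeι with hL
  set j := ((C.comap (Scheme.IdealSheafData.vanishingIdeal (⟨S, hS⟩ : Closeds X)).subschemeι).comap ρ).subschemeι ≫
        (Scheme.IdealSheafData.vanishingIdeal
          (⟨closure (τ ⁻¹' (S \ (C.support : Set X))), isClosed_closure⟩ : Closeds X')).subschemeι with hj
  have hker : L.subschemeι.ker = j.ker := by
    rw [Scheme.IdealSheafData.ker_subschemeι, hL, hj, inCarrier_eq_ker τ C S hS ρ hcomm]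
  haveI := IsClosedImmersion.isIso_lift _ j hker
  exact Scheme.IsRegular.of_isOpenImmersion (inv (IsClosedImmersion.lift L.subschemeι j hker.le)) hE

/-- **R1-IN-CARRIER, flatness.** If `D = V(S)_red` and `V(C·𝒪_D)` are regular and `V(C·𝒪_D) ↪ D → X → Spec O` is flat
(e.g. `V(C·𝒪_D) = s ≅ Spec O` a section), then the in-carrier centre is FLAT over `Spec O` along
`V(L) ↪ X' → X → Spec O`: `V(L) ≅ E_T` and `E_T → D → Spec O` is flat by the tree theorem
`StrataSplit.flat_exceptional_of_isBlowup_regularCentre` (p460210) applied to `ρ`, since `ρ ≫ ι_D = ι_T ≫ τ`. [folklore] -/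
theorem flat_inCarrier_comp (O : Type) [CommRing O] (X X' : Scheme.{0}) [IsLocallyNoetherian X]
    [IsLocallyNoetherian X'] (q : X ⟶ Spec (.of O)) (τ : X' ⟶ X) (C : X.IdealSheafData) (hτ : IsBlowup τ C)
    [IsProper τ] (S : Set X) (hS : IsClosed S) (hirr : IsIrreducible S) (hSC : ¬ S ⊆ (C.support : Set X))
    (hD : Scheme.IsRegular (Scheme.IdealSheafData.vanishingIdeal (⟨S, hS⟩ : Closeds X)).subscheme)
    (hJ : Scheme.IsRegular (C.comap (Scheme.IdealSheafData.vanishingIdeal (⟨S, hS⟩ : Closeds X)).subschemeι).subscheme)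
    (hflat : Flat ((C.comap (Scheme.IdealSheafData.vanishingIdeal (⟨S, hS⟩ : Closeds X)).subschemeι).subschemeι ≫
      (Scheme.IdealSheafData.vanishingIdeal (⟨S, hS⟩ : Closeds X)).subschemeι ≫ q)) :
    Flat ((((C.comap τ).comap (Scheme.IdealSheafData.vanishingIdeal
        (⟨closure (τ ⁻¹' (S \ (C.support : Set X))), isClosed_closure⟩ : Closeds X')).subschemeι).map
        (Scheme.IdealSheafData.vanishingIdeal
          (⟨closure (τ ⁻¹' (S \ (C.support : Set X))), isClosed_closure⟩ : Closeds X')).subschemeι).subschemeι ≫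
      τ ≫ q) := by
  obtain ⟨ρ, hcomm, -, hρ⟩ := exists_isBlowup_reducedStrictTransform X X' τ C hτ S hS hirr hSC
  haveI : IsLocallyNoetherian (Scheme.IdealSheafData.vanishingIdeal (⟨S, hS⟩ : Closeds X)).subscheme :=
    LocallyOfFiniteType.isLocallyNoetherian
      (Scheme.IdealSheafData.vanishingIdeal (⟨S, hS⟩ : Closeds X)).subschemeι
  -- `E_T ↪ T → D → X → Spec O` is flat
  have hE : Flat (((C.comap (Scheme.IdealSheafData.vanishingIdeal (⟨S, hS⟩ : Closeds X)).subschemeι).comap ρ).subschemeι ≫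
      ρ ≫ (Scheme.IdealSheafData.vanishingIdeal (⟨S, hS⟩ : Closeds X)).subschemeι ≫ q) :=
    flat_exceptional_of_isBlowup_regularCentre O _ _
      ((Scheme.IdealSheafData.vanishingIdeal (⟨S, hS⟩ : Closeds X)).subschemeι ≫ q) _ hD hJ hflat ρ hρ
  set L := ((C.comap τ).comap (Scheme.IdealSheafData.vanishingIdeal
        (⟨closure (τ ⁻¹' (S \ (C.support : Set X))), isClosed_closure⟩ : Closeds X')).subschemeι).map
        (Scheme.IdealSheafData.vanishingIdeal
          (⟨closure (τ ⁻¹' (S \ (C.support : Set X))), isClosed_closure⟩ : Closeds X')).subschemeι with hL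
  set j := ((C.comap (Scheme.IdealSheafData.vanishingIdeal (⟨S, hS⟩ : Closeds X)).subschemeι).comap ρ).subschemeι ≫
        (Scheme.IdealSheafData.vanishingIdeal
          (⟨closure (τ ⁻¹' (S \ (C.support : Set X))), isClosed_closure⟩ : Closeds X')).subschemeι with hj
  have hker : L.subschemeι.ker = j.ker := by
    rw [Scheme.IdealSheafData.ker_subschemeι, hL, hj, inCarrier_eq_ker τ C S hS ρ hcomm]
  haveI := IsClosedImmersion.isIso_lift _ j hker
  set e := IsClosedImmersion.lift L.subschemeι j hker.le with he
  -- `ι_L = e⁻¹ ≫ E_T.ι ≫ ι_T`, and `ι_T ≫ τ = ρ ≫ ι_D`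
  have hfac : L.subschemeι ≫ τ ≫ q =
      inv e ≫ (((C.comap (Scheme.IdealSheafData.vanishingIdeal (⟨S, hS⟩ : Closeds X)).subschemeι).comap ρ).subschemeι ≫
        ρ ≫ (Scheme.IdealSheafData.vanishingIdeal (⟨S, hS⟩ : Closeds X)).subschemeι ≫ q) := by
    have h1 : L.subschemeι = inv e ≫ j := by
      rw [IsIso.eq_inv_comp, he, IsClosedImmersion.lift_fac]
    rw [h1, hj, Category.assoc, Category.assoc, ← Category.assoc _ τ, ← hcomm, Category.assoc]
  rw [hfac]
  haveI := hE
  infer_instance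

/-- **R1-IN-CARRIER, bundled in the order of a HorizChainE1 step** (res-L1-w45b-lead-2 05:23:05Z currency): the in-carrier
centre `L` on `X'` has `V(L)` regular, `V(L) ↪ X' → X → Spec O` flat, lies over `V(C)` (so over whatever non-generic
point the old centre lay over), and has support `St(S) ∩ τ⁻¹V(C)` (for the E1 check `supp L ∩ X'_k ⊆ Y'`). [folklore] -/
theorem inCarrier_stepData (O : Type) [CommRing O] (X X' : Scheme.{0}) [IsLocallyNoetherian X]
    [IsLocallyNoetherian X'] (q : X ⟶ Spec (.of O)) (τ : X' ⟶ X) (C : X.IdealSheafData) (hτ : IsBlowup τ C)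
    [IsProper τ] (S : Set X) (hS : IsClosed S) (hirr : IsIrreducible S) (hSC : ¬ S ⊆ (C.support : Set X))
    (hD : Scheme.IsRegular (Scheme.IdealSheafData.vanishingIdeal (⟨S, hS⟩ : Closeds X)).subscheme)
    (hJ : Scheme.IsRegular (C.comap (Scheme.IdealSheafData.vanishingIdeal (⟨S, hS⟩ : Closeds X)).subschemeι).subscheme)
    (hflat : Flat ((C.comap (Scheme.IdealSheafData.vanishingIdeal (⟨S, hS⟩ : Closeds X)).subschemeι).subschemeι ≫
      (Scheme.IdealSheafData.vanishingIdeal (⟨S, hS⟩ : Closeds X)).subschemeι ≫ q)) :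
    Scheme.IsRegular (((C.comap τ).comap (Scheme.IdealSheafData.vanishingIdeal
        (⟨closure (τ ⁻¹' (S \ (C.support : Set X))), isClosed_closure⟩ : Closeds X')).subschemeι).map
        (Scheme.IdealSheafData.vanishingIdeal
          (⟨closure (τ ⁻¹' (S \ (C.support : Set X))), isClosed_closure⟩ : Closeds X')).subschemeι).subscheme ∧
    Flat ((((C.comap τ).comap (Scheme.IdealSheafData.vanishingIdeal
        (⟨closure (τ ⁻¹' (S \ (C.support : Set X))), isClosed_closure⟩ : Closeds X')).subschemeι).map
        (Scheme.IdealSheafData.vanishingIdeal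
          (⟨closure (τ ⁻¹' (S \ (C.support : Set X))), isClosed_closure⟩ : Closeds X')).subschemeι).subschemeι ≫
      τ ≫ q) ∧
    τ '' ((((C.comap τ).comap (Scheme.IdealSheafData.vanishingIdeal
        (⟨closure (τ ⁻¹' (S \ (C.support : Set X))), isClosed_closure⟩ : Closeds X')).subschemeι).map
        (Scheme.IdealSheafData.vanishingIdeal
          (⟨closure (τ ⁻¹' (S \ (C.support : Set X))), isClosed_closure⟩ : Closeds X')).subschemeι).support : Set X') ⊆
      (C.support : Set X) ∧
    ((((C.comap τ).comap (Scheme.IdealSheafData.vanishingIdeal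
        (⟨closure (τ ⁻¹' (S \ (C.support : Set X))), isClosed_closure⟩ : Closeds X')).subschemeι).map
        (Scheme.IdealSheafData.vanishingIdeal
          (⟨closure (τ ⁻¹' (S \ (C.support : Set X))), isClosed_closure⟩ : Closeds X')).subschemeι).support : Set X') =
      closure (τ ⁻¹' (S \ (C.support : Set X))) ∩ τ ⁻¹' (C.support : Set X) :=
  ⟨isRegular_inCarrier X X' τ C hτ S hS hirr hSC hD hJ,
    flat_inCarrier_comp O X X' q τ C hτ S hS hirr hSC hD hJ hflat,
    image_support_inCarrier_subset τ C S, support_inCarrier τ C S⟩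


/-! ## rev 2 (append-only): the carrier given by an IDEAL SHEAF `K ≤ C`; discharging `hD`, `hJ`, `hflat` -/

/-- For an ideal sheaf with reduced subscheme, the ideal of its support is the ideal itself:
`𝓘(supp K) = K` (`= ker ι_K`, via `map_vanishingIdeal` and `nilradical V(K) = ⊥`). [folklore] -/
theorem vanishingIdeal_support_eq_of_isReduced {X : Scheme.{0}} (K : X.IdealSheafData) [IsReduced K.subscheme] :
    Scheme.IdealSheafData.vanishingIdeal K.support = K := by
  have h : (Scheme.IdealSheafData.vanishingIdeal (⊤ : Closeds K.subscheme)).map K.subschemeι = K := by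
    rw [Scheme.IdealSheafData.vanishingIdeal_top, Scheme.nilradical_eq_bot, Scheme.IdealSheafData.map_bot,
      Scheme.IdealSheafData.ker_subschemeι]
  have h2 : (Scheme.IdealSheafData.vanishingIdeal (⊤ : Closeds K.subscheme)).map K.subschemeι =
      Scheme.IdealSheafData.vanishingIdeal K.support := by
    rw [Scheme.IdealSheafData.map_vanishingIdeal]
    congr 1
    ext1
    rw [Closeds.coe_closure, Closeds.coe_top, Set.image_univ, Scheme.IdealSheafData.range_subschemeι,
      K.support.isClosed.closure_eq]
  rw [← h2, h]

/-- **`V(K·𝒪_{V(I)}) ≅ V(K)` over `X` when `I ≤ K`** (a closed subscheme restricted to a bigger closed subscheme is itself):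
the composite `V(K.comap ι_I) ↪ V(I) ↪ X` has kernel `(K.comap ι_I).map ι_I = I ⊔ K = K` (`map_comap_subschemeι_eq_sup`).
[folklore] -/
theorem exists_iso_comap_subscheme_of_le {X : Scheme.{0}} {I K : X.IdealSheafData} (h : I ≤ K) :
    ∃ e : (K.comap I.subschemeι).subscheme ≅ K.subscheme,
      e.hom ≫ K.subschemeι = (K.comap I.subschemeι).subschemeι ≫ I.subschemeι := by
  have hker : K.subschemeι.ker = ((K.comap I.subschemeι).subschemeι ≫ I.subschemeι).ker := by
    rw [Scheme.IdealSheafData.ker_subschemeι]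
    change K = (K.comap I.subschemeι).map I.subschemeι
    rw [map_comap_subschemeι_eq_sup, sup_eq_right.mpr h]
  haveI := IsClosedImmersion.isIso_lift _ _ hker
  exact ⟨asIso (IsClosedImmersion.lift K.subschemeι ((K.comap I.subschemeι).subschemeι ≫ I.subschemeι) hker.le),
    IsClosedImmersion.lift_fac _ _ _⟩

/-- `I ≤ K`, `V(K)` regular ⇒ `V(K·𝒪_{V(I)})` regular. [folklore] -/
theorem isRegular_comap_subscheme_of_le {X : Scheme.{0}} {I K : X.IdealSheafData} (h : I ≤ K)
    (hK : Scheme.IsRegular K.subscheme) : Scheme.IsRegular (K.comap I.subschemeι).subscheme := by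
  obtain ⟨e, -⟩ := exists_iso_comap_subscheme_of_le h
  exact Scheme.IsRegular.of_isOpenImmersion e.hom hK

/-- `I ≤ K`, `V(K) ↪ X → Y` flat ⇒ `V(K·𝒪_{V(I)}) ↪ V(I) ↪ X → Y` flat. [folklore] -/
theorem flat_comap_subschemeι_comp_of_le {X Y : Scheme.{0}} {I K : X.IdealSheafData} (h : I ≤ K) (g : X ⟶ Y)
    (hK : Flat (K.subschemeι ≫ g)) : Flat ((K.comap I.subschemeι).subschemeι ≫ I.subschemeι ≫ g) := by
  obtain ⟨e, he⟩ := exists_iso_comap_subscheme_of_le h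
  rw [← Category.assoc, ← he, Category.assoc]
  haveI := hK
  infer_instance

/-- **R1-IN-CARRIER for a carrier given by an ideal sheaf** (the shape R1's linear centres come in): `K` a carrier ideal
(e.g. the `O`-plane `Λ_plane`) with `V(K)` regular and `supp K` irreducible, and a centre `C ≥ K` (e.g. the section / `O`-point
`Λ_point ⊂ Λ_plane`) with `V(C)` regular and `V(C) ↪ X → Spec O` flat and `supp K ⊄ supp C`. Then for the proper blow-up `τ`
along `C` the in-carrier centre `L` built on `S := supp K` satisfies the four step entries of `inCarrier_stepData`.
(Hypotheses of `inCarrier_stepData` discharged by `vanishingIdeal_support_eq_of_isReduced`, `isRegular_comap_subscheme_of_le`,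
`flat_comap_subschemeι_comp_of_le`; with R1 (res-D-pv-013 p505223) `LinearCentre.isRegular_kerSubscheme` /
`flat_kerSubschemeι_comp` for plane and point this is the LINE-IN-POINT-CARRIER `ℓ̃ = E_s ∩ St(Π̃)`.) [folklore] -/
theorem inCarrier_stepData_of_le (O : Type) [CommRing O] (X X' : Scheme.{0}) [IsLocallyNoetherian X]
    [IsLocallyNoetherian X'] (q : X ⟶ Spec (.of O)) (τ : X' ⟶ X) (K C : X.IdealSheafData) (hKC : K ≤ C)
    (hτ : IsBlowup τ C) [IsProper τ] (hK : Scheme.IsRegular K.subscheme)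
    (hirr : IsIrreducible (K.support : Set X)) (hSC : ¬ (K.support : Set X) ⊆ (C.support : Set X))
    (hC : Scheme.IsRegular C.subscheme) (hCflat : Flat (C.subschemeι ≫ q)) :
    Scheme.IsRegular (((C.comap τ).comap (Scheme.IdealSheafData.vanishingIdeal
        (⟨closure (τ ⁻¹' ((K.support : Set X) \ (C.support : Set X))), isClosed_closure⟩ : Closeds X')).subschemeι).map
        (Scheme.IdealSheafData.vanishingIdeal
          (⟨closure (τ ⁻¹' ((K.support : Set X) \ (C.support : Set X))), isClosed_closure⟩ : Closeds X')).subschemeι).subscheme ∧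
    Flat ((((C.comap τ).comap (Scheme.IdealSheafData.vanishingIdeal
        (⟨closure (τ ⁻¹' ((K.support : Set X) \ (C.support : Set X))), isClosed_closure⟩ : Closeds X')).subschemeι).map
        (Scheme.IdealSheafData.vanishingIdeal
          (⟨closure (τ ⁻¹' ((K.support : Set X) \ (C.support : Set X))), isClosed_closure⟩ : Closeds X')).subschemeι).subschemeι ≫
      τ ≫ q) ∧
    τ '' ((((C.comap τ).comap (Scheme.IdealSheafData.vanishingIdeal
        (⟨closure (τ ⁻¹' ((K.support : Set X) \ (C.support : Set X))), isClosed_closure⟩ : Closeds X')).subschemeι).map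
        (Scheme.IdealSheafData.vanishingIdeal
          (⟨closure (τ ⁻¹' ((K.support : Set X) \ (C.support : Set X))), isClosed_closure⟩ : Closeds X')).subschemeι).support : Set X') ⊆
      (C.support : Set X) ∧
    ((((C.comap τ).comap (Scheme.IdealSheafData.vanishingIdeal
        (⟨closure (τ ⁻¹' ((K.support : Set X) \ (C.support : Set X))), isClosed_closure⟩ : Closeds X')).subschemeι).map
        (Scheme.IdealSheafData.vanishingIdeal
          (⟨closure (τ ⁻¹' ((K.support : Set X) \ (C.support : Set X))), isClosed_closure⟩ : Closeds X')).subschemeι).support : Set X') =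
      closure (τ ⁻¹' ((K.support : Set X) \ (C.support : Set X))) ∩ τ ⁻¹' (C.support : Set X) := by
  -- `V(K)` regular ⇒ reduced, so `𝓘(supp K) = K`
  haveI : IsReduced K.subscheme := by
    haveI : ∀ x : K.subscheme, _root_.IsReduced (K.subscheme.presheaf.stalk x) := fun x => by
      haveI := hK x
      haveI := isDomain_of_isRegularLocalRing (K.subscheme.presheaf.stalk x)
      infer_instance
    exact isReduced_of_isReduced_stalk K.subscheme
  have hKe : Scheme.IdealSheafData.vanishingIdeal (⟨(K.support : Set X), K.support.isClosed⟩ : Closeds X) = K :=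
    vanishingIdeal_support_eq_of_isReduced K
  have hle : Scheme.IdealSheafData.vanishingIdeal (⟨(K.support : Set X), K.support.isClosed⟩ : Closeds X) ≤ C :=
    hKe.le.trans hKC
  have hD : Scheme.IsRegular
      (Scheme.IdealSheafData.vanishingIdeal (⟨(K.support : Set X), K.support.isClosed⟩ : Closeds X)).subscheme := by
    rw [hKe]; exact hK
  exact inCarrier_stepData O X X' q τ C hτ (K.support : Set X) K.support.isClosed hirr hSC hD
    (isRegular_comap_subscheme_of_le hle hC) (flat_comap_subschemeι_comp_of_le hle q hCflat)

end Summit.ResolutionOfSingularities.ResolutionOfSingularities.Cruxes.EquisingularLiftNat.Sections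

end
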